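import Mathlib
import Literature.NumberTheory.Irrationality.Fischler2002.EulerKernelBoundsProofs
import HarnessLib

/-!
# Fischler's finiteness criterion for `𝒥(p)` — II: lower bounds and divergence for the Euler kernel

Topic `Literature/NumberTheory/Irrationality/Fischler2002`; proofs-only companion of `RhinViolaGroupsGeneral.lean`
(named fact `Jn_finite_iff`) and `FamilyJ.lean` (`integralJ_finite_iff`), continuing `EulerKernelBoundsProofs.lean`.
Source: S. Fischler, « Formes linéaires en polyzêtas et intégrales multiples », C. R. Acad. Sci. Paris Sér. I **335**
(2002) 1–4 = arXiv:math/0202064 [Fischler2002Polyzetas], §3 p. 4; proof in S. Fischler, *Groupes de Rhin-Viola et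
intégrales multiples*, J. Théor. Nombres Bordeaux **15** (2003) 479–534 [Fischler2003RhinViola], §4.1 Proposition 13
(cell `pub-zeta5`, seat ct-1 g32, 2026-08-27).

HONEST FRAMING (cells pub-zeta5 / zeta5-irr): systematic search; no irrationality claim unless certified. Real analysis
only (estimates of one-variable integrals of non-negative functions); nothing about `ζ(5)`.

## Contents (the one-variable step of the criterion, «only if» half)
For the EULER KERNEL `t^α (1−t)^β (1 − tδ)^{−γ}` (real exponents, lower Lebesgue integrals over `(0,1)`):
* `le_lintegral_eulerKernel` — LOWER bound `∫ ≥ c·(1−δ)^{−(γ−β−1)⁺}` uniformly in `δ ∈ [0,1)` (`β > −1`), from the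
  uniform bound `const_le_lintegral_eulerKernel` (restriction to `t ∈ (1/4,1/2)`) and the bound near `δ = 1`
  `rpow_le_lintegral_eulerKernel` (restriction to `t ∈ (δ,(1+δ)/2)`, where `1 − tδ ≤ 2(1−δ)`);
* `lintegral_eulerKernel_eq_top_of_le_left/right` — DIVERGENCE `∫ = ∞` when `α ≤ −1` or `β ≤ −1` (Mathlib's
  `intervalIntegral.integrableOn_Ioo_rpow_iff`, reflected by `t ↦ 1 − t` for the right end point).
Theorems only, no definition, no new named fact.
-/

noncomputable section

namespace Literature.NumberTheory.Irrationality.Fischler2002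

open MeasureTheory Set
open scoped ENNReal

namespace JnFinite

/-! ### Lower bounds -/

/-- **Uniform positive lower bound**: for every `δ ∈ [0,1]`,
`∫₀¹ t^α(1−t)^β(1−tδ)^{−γ}dt ≥ 2^{−|α|}·2^{−|α|}·2^{−|β|}·2^{−|γ|}/4` (restrict to `t ∈ (1/4, 1/2)`, where
`t ≥ 1/4 = (1/2)²`, `1 − t ≥ 1/2` and `1 − tδ ≥ 1/2`). [cite: Fischler2003RhinViola, §4.1 Proposition 13 (one-variable estimates)] -/
theorem const_le_lintegral_eulerKernel (α β γ : ℝ) {δ : ℝ} (hδ0 : 0 ≤ δ) (hδ1 : δ ≤ 1) :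
    ENNReal.ofReal ((2 : ℝ) ^ (-|α|) * (2 : ℝ) ^ (-|α|) * (2 : ℝ) ^ (-|β|) * (2 : ℝ) ^ (-|γ|) * (1 / 4)) ≤
      ∫⁻ t in Ioo (0 : ℝ) 1, ENNReal.ofReal (t ^ α * (1 - t) ^ β * (1 - t * δ) ^ (-γ)) := by
  set κ : ℝ := (2 : ℝ) ^ (-|α|) * (2 : ℝ) ^ (-|α|) * (2 : ℝ) ^ (-|β|) * (2 : ℝ) ^ (-|γ|) with hκ
  have hpt : ∀ t ∈ Ioo (1 / 4 : ℝ) (1 / 2), κ ≤ t ^ α * (1 - t) ^ β * (1 - t * δ) ^ (-γ) := by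
    intro t ht
    have ht0 : 0 < t := by linarith [ht.1]
    -- `t = √t · √t` with `√t ∈ [1/2, 1]`
    have hsq : (1 / 2 : ℝ) ≤ Real.sqrt t := by
      have h14 : Real.sqrt (1 / 4 : ℝ) = 1 / 2 := by
        rw [show (1 / 4 : ℝ) = (1 / 2) ^ 2 by norm_num]
        exact Real.sqrt_sq (by norm_num)
      rw [← h14]
      exact Real.sqrt_le_sqrt ht.1.le
    have hsq1 : Real.sqrt t ≤ 1 := by
      rw [show (1 : ℝ) = Real.sqrt 1 by simp]
      exact Real.sqrt_le_sqrt (by linarith [ht.2])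
    have hta : (2 : ℝ) ^ (-|α|) * (2 : ℝ) ^ (-|α|) ≤ t ^ α := by
      have h := two_rpow_neg_abs_le (z := α) hsq hsq1
      have ht' : t ^ α = Real.sqrt t ^ α * Real.sqrt t ^ α := by
        rw [← Real.mul_rpow (Real.sqrt_nonneg _) (Real.sqrt_nonneg _), Real.mul_self_sqrt ht0.le]
      rw [ht']
      exact mul_le_mul h h (by positivity) (Real.rpow_nonneg (Real.sqrt_nonneg _) _)
    have htb : (2 : ℝ) ^ (-|β|) ≤ (1 - t) ^ β := two_rpow_neg_abs_le (by linarith [ht.2]) (by linarith [ht.1])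
    have htc : (2 : ℝ) ^ (-|γ|) ≤ (1 - t * δ) ^ (-γ) := by
      have h1 : t * δ ≤ 1 / 2 * 1 := mul_le_mul ht.2.le hδ1 hδ0 (by norm_num)
      have h2 : 0 ≤ t * δ := mul_nonneg ht0.le hδ0
      have h := two_rpow_neg_abs_le (z := -γ) (x := 1 - t * δ) (by linarith) (by linarith)
      rwa [abs_neg] at h
    rw [hκ]
    exact mul_le_mul (mul_le_mul hta htb (by positivity) (Real.rpow_nonneg ht0.le _)) htc (by positivity)
      (mul_nonneg (Real.rpow_nonneg ht0.le _) (Real.rpow_nonneg (by linarith [ht.2]) _))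
  have hsub : Ioo (1 / 4 : ℝ) (1 / 2) ⊆ Ioo (0 : ℝ) 1 := fun t ht => ⟨by linarith [ht.1], by linarith [ht.2]⟩
  have hκ0 : 0 ≤ κ := by rw [hκ]; positivity
  calc ENNReal.ofReal (κ * (1 / 4))
      = ENNReal.ofReal κ * volume (Ioo (1 / 4 : ℝ) (1 / 2)) := by
        rw [Real.volume_Ioo, ENNReal.ofReal_mul hκ0]; norm_num
    _ = ∫⁻ _ in Ioo (1 / 4 : ℝ) (1 / 2), ENNReal.ofReal κ := (setLIntegral_const _ _).symm
    _ ≤ ∫⁻ t in Ioo (1 / 4 : ℝ) (1 / 2), ENNReal.ofReal (t ^ α * (1 - t) ^ β * (1 - t * δ) ^ (-γ)) :=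
        setLIntegral_mono' measurableSet_Ioo fun t ht => ENNReal.ofReal_le_ofReal (hpt t ht)
    _ ≤ ∫⁻ t in Ioo (0 : ℝ) 1, ENNReal.ofReal (t ^ α * (1 - t) ^ β * (1 - t * δ) ^ (-γ)) :=
        lintegral_mono_set hsub

/-- **Lower bound near `δ = 1`**: for `δ ∈ [1/2, 1)` and `γ > 0`,
`∫₀¹ t^α(1−t)^β(1−tδ)^{−γ}dt ≥ 2^{−|α|}2^{−|β|}2^{−|γ|}/2 · (1−δ)^{β+1−γ}` (restrict to `t ∈ (δ, (1+δ)/2)`, where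
`1 − tδ ≤ 2(1−δ)` and `(1−δ)/2 ≤ 1 − t ≤ 1 − δ`). [cite: Fischler2003RhinViola, §4.1 Proposition 13 (one-variable estimates)] -/
theorem rpow_le_lintegral_eulerKernel (α β : ℝ) {γ δ : ℝ} (hγ : 0 < γ) (hδ0 : 1 / 2 ≤ δ) (hδ1 : δ < 1) :
    ENNReal.ofReal ((2 : ℝ) ^ (-|α|) * (2 : ℝ) ^ (-|β|) * (2 : ℝ) ^ (-|γ|) * (1 / 2) * (1 - δ) ^ (β + 1 - γ)) ≤
      ∫⁻ t in Ioo (0 : ℝ) 1, ENNReal.ofReal (t ^ α * (1 - t) ^ β * (1 - t * δ) ^ (-γ)) := by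
  have h1δ : 0 < 1 - δ := by linarith
  set κ : ℝ := (2 : ℝ) ^ (-|α|) * (2 : ℝ) ^ (-|β|) * (2 : ℝ) ^ (-|γ|) with hκ
  have hκ0 : 0 ≤ κ := by rw [hκ]; positivity
  have hpt : ∀ t ∈ Ioo δ ((1 + δ) / 2), κ * (1 - δ) ^ (β - γ) ≤ t ^ α * (1 - t) ^ β * (1 - t * δ) ^ (-γ) := by
    intro t ht
    have ht0 : 0 < t := by linarith [ht.1]
    have ht1 : t < 1 := by linarith [ht.2]
    have hta : (2 : ℝ) ^ (-|α|) ≤ t ^ α := two_rpow_neg_abs_le (by linarith [ht.1]) ht1.le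
    -- `(1−t)^β ≥ 2^{−|β|} (1−δ)^β` from `(1−t)/(1−δ) ∈ [1/2, 1]`
    have hq : 1 / 2 ≤ (1 - t) / (1 - δ) := by rw [le_div_iff₀ h1δ]; linarith [ht.2]
    have hq1 : (1 - t) / (1 - δ) ≤ 1 := by rw [div_le_one h1δ]; linarith [ht.1]
    have htb : (2 : ℝ) ^ (-|β|) * (1 - δ) ^ β ≤ (1 - t) ^ β := by
      have h := two_rpow_neg_abs_le (z := β) hq hq1
      rw [Real.div_rpow (by linarith) h1δ.le, le_div_iff₀ (Real.rpow_pos_of_pos h1δ _)] at h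
      exact h
    -- `(1−tδ)^{−γ} ≥ (2(1−δ))^{−γ} = 2^{−γ}(1−δ)^{−γ}` from `1 − tδ ≤ 1 − δ² ≤ 2(1−δ)`
    have hden : 1 - t * δ ≤ 2 * (1 - δ) := by
      nlinarith [mul_nonneg (sub_nonneg.2 ht.1.le) (by linarith : (0:ℝ) ≤ δ), sq_nonneg (1 - δ)]
    have hden0 : 0 < 1 - t * δ := by
      have : t * δ < 1 * 1 := mul_lt_mul'' ht1 hδ1 ht0.le (by linarith : (0:ℝ) ≤ δ)
      linarith
    have htc : (2 : ℝ) ^ (-|γ|) * (1 - δ) ^ (-γ) ≤ (1 - t * δ) ^ (-γ) := by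
      have h : (2 * (1 - δ)) ^ (-γ) ≤ (1 - t * δ) ^ (-γ) :=
        Real.rpow_le_rpow_of_nonpos hden0 hden (by linarith)
      have h2 : (2 : ℝ) ^ (-γ) = (2 : ℝ) ^ (-|γ|) := by rw [abs_of_pos hγ]
      rwa [Real.mul_rpow (by norm_num) h1δ.le, h2] at h
    have hprod : κ * (1 - δ) ^ (β - γ) =
        (2 : ℝ) ^ (-|α|) * ((2 : ℝ) ^ (-|β|) * (1 - δ) ^ β) * ((2 : ℝ) ^ (-|γ|) * (1 - δ) ^ (-γ)) := by
      rw [hκ, show β - γ = β + (-γ) by ring, Real.rpow_add h1δ]; ring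
    rw [hprod]
    have h1t : 0 ≤ 1 - t := by linarith
    exact mul_le_mul (mul_le_mul hta htb (by positivity) (Real.rpow_nonneg ht0.le _)) htc (by positivity)
      (mul_nonneg (Real.rpow_nonneg ht0.le _) (Real.rpow_nonneg h1t _))
  have hsub : Ioo δ ((1 + δ) / 2) ⊆ Ioo (0 : ℝ) 1 := fun t ht => ⟨by linarith [ht.1], by linarith [ht.2]⟩
  have hvol : volume (Ioo δ ((1 + δ) / 2)) = ENNReal.ofReal ((1 - δ) / 2) := by
    rw [Real.volume_Ioo]; congr 1; ring
  calc ENNReal.ofReal (κ * (1 / 2) * (1 - δ) ^ (β + 1 - γ))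
      = ENNReal.ofReal (κ * (1 - δ) ^ (β - γ)) * volume (Ioo δ ((1 + δ) / 2)) := by
        rw [hvol, ← ENNReal.ofReal_mul (by positivity)]
        congr 1
        rw [show β + 1 - γ = (β - γ) + 1 by ring, Real.rpow_add h1δ, Real.rpow_one]
        ring
    _ = ∫⁻ _ in Ioo δ ((1 + δ) / 2), ENNReal.ofReal (κ * (1 - δ) ^ (β - γ)) := (setLIntegral_const _ _).symm
    _ ≤ ∫⁻ t in Ioo δ ((1 + δ) / 2), ENNReal.ofReal (t ^ α * (1 - t) ^ β * (1 - t * δ) ^ (-γ)) :=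
        setLIntegral_mono' measurableSet_Ioo fun t ht => ENNReal.ofReal_le_ofReal (hpt t ht)
    _ ≤ ∫⁻ t in Ioo (0 : ℝ) 1, ENNReal.ofReal (t ^ α * (1 - t) ^ β * (1 - t * δ) ^ (-γ)) :=
        lintegral_mono_set hsub

/-- **Lower bound for the Euler kernel, uniform in `δ ∈ [0,1)`**: there is `c > 0` with
`∫₀¹ t^α(1−t)^β(1−tδ)^{−γ}dt ≥ c·(1−δ)^{−(γ−β−1)⁺}` for all `δ ∈ [0,1)`.
[cite: Fischler2003RhinViola, §4.1 Proposition 13 (one-variable estimates)] -/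
theorem le_lintegral_eulerKernel (α γ : ℝ) {β : ℝ} (hβ : -1 < β) :
    ∃ c : ℝ, 0 < c ∧ ∀ δ : ℝ, 0 ≤ δ → δ < 1 →
      ENNReal.ofReal (c * (1 - δ) ^ (-(max (γ - β - 1) 0))) ≤
        ∫⁻ t in Ioo (0 : ℝ) 1, ENNReal.ofReal (t ^ α * (1 - t) ^ β * (1 - t * δ) ^ (-γ)) := by
  set ρ : ℝ := max (γ - β - 1) 0 with hρ
  have hρ0 : 0 ≤ ρ := le_max_right _ _
  set c₁ : ℝ := (2 : ℝ) ^ (-|α|) * (2 : ℝ) ^ (-|α|) * (2 : ℝ) ^ (-|β|) * (2 : ℝ) ^ (-|γ|) * (1 / 4) with hc₁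
  set c₂ : ℝ := (2 : ℝ) ^ (-|α|) * (2 : ℝ) ^ (-|β|) * (2 : ℝ) ^ (-|γ|) * (1 / 2) with hc₂
  have hc₁0 : 0 < c₁ := by rw [hc₁]; positivity
  have hc₂0 : 0 < c₂ := by rw [hc₂]; positivity
  refine ⟨min (c₁ * (2 : ℝ) ^ (-ρ)) c₂, lt_min (by positivity) hc₂0, fun δ hδ0 hδ1 => ?_⟩
  have h1δ : 0 < 1 - δ := by linarith
  rcases lt_or_ge δ (1 / 2) with hδ | hδ
  · -- `δ < 1/2`: `(1−δ)^{−ρ} ≤ 2^{ρ}`, use the uniform bound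
    have hA : (1 - δ) ^ (-ρ) ≤ (2 : ℝ) ^ ρ := by
      have h := rpow_le_two_rpow_abs (z := -ρ) (x := 1 - δ) (by linarith) (by linarith)
      rwa [abs_neg, abs_of_nonneg hρ0] at h
    calc ENNReal.ofReal (min (c₁ * (2 : ℝ) ^ (-ρ)) c₂ * (1 - δ) ^ (-ρ))
        ≤ ENNReal.ofReal (c₁ * (2 : ℝ) ^ (-ρ) * (2 : ℝ) ^ ρ) := by
          refine ENNReal.ofReal_le_ofReal ?_
          exact mul_le_mul (min_le_left _ _) hA (Real.rpow_nonneg h1δ.le _) (by positivity)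
      _ = ENNReal.ofReal c₁ := by
          rw [mul_assoc, ← Real.rpow_add (by norm_num : (0 : ℝ) < 2), neg_add_cancel, Real.rpow_zero, mul_one]
      _ ≤ _ := by rw [hc₁]; exact const_le_lintegral_eulerKernel α β γ hδ0 hδ1.le
  · rcases le_or_gt (γ - β - 1) 0 with hneg | hpos
    · -- `ρ = 0`: the uniform bound suffices
      have hρ' : ρ = 0 := by rw [hρ, max_eq_right hneg]
      calc ENNReal.ofReal (min (c₁ * (2 : ℝ) ^ (-ρ)) c₂ * (1 - δ) ^ (-ρ))
          ≤ ENNReal.ofReal c₁ := by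
            refine ENNReal.ofReal_le_ofReal ?_
            rw [hρ', neg_zero, Real.rpow_zero, Real.rpow_zero, mul_one, mul_one]
            exact min_le_left _ _
        _ ≤ _ := by rw [hc₁]; exact const_le_lintegral_eulerKernel α β γ hδ0 hδ1.le
    · -- `ρ = γ − β − 1 > 0`, `δ ≥ 1/2`: the bound near `δ = 1`
      have hρ' : ρ = γ - β - 1 := by rw [hρ, max_eq_left hpos.le]
      have hγ : 0 < γ := by linarith
      calc ENNReal.ofReal (min (c₁ * (2 : ℝ) ^ (-ρ)) c₂ * (1 - δ) ^ (-ρ))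
          ≤ ENNReal.ofReal (c₂ * (1 - δ) ^ (β + 1 - γ)) := by
            refine ENNReal.ofReal_le_ofReal ?_
            rw [hρ', show -(γ - β - 1) = β + 1 - γ by ring]
            exact mul_le_mul_of_nonneg_right (min_le_right _ _) (Real.rpow_nonneg h1δ.le _)
        _ ≤ _ := by rw [hc₂]; exact rpow_le_lintegral_eulerKernel α β hγ hδ hδ1


/-! ### Divergence -/

/-- `∫⁻_{(0,1/2)} ofReal(t^α) = ∞` for `α ≤ −1` (Mathlib's `intervalIntegral.integrableOn_Ioo_rpow_iff`).
[cite: Fischler2003RhinViola, §4.1 Proposition 13 (one-variable estimates)] -/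
theorem lintegral_rpow_eq_top {α : ℝ} (hα : α ≤ -1) :
    ∫⁻ t in Ioo (0 : ℝ) (1 / 2), ENNReal.ofReal (t ^ α) = ∞ := by
  by_contra hne
  have hlt : ∫⁻ t in Ioo (0 : ℝ) (1 / 2), ENNReal.ofReal (t ^ α) < ∞ := lt_top_iff_ne_top.2 hne
  have hnn : 0 ≤ᵐ[volume.restrict (Ioo (0 : ℝ) (1 / 2))] fun t : ℝ => t ^ α :=
    (ae_restrict_iff' measurableSet_Ioo).2 (Filter.Eventually.of_forall fun t ht => Real.rpow_nonneg ht.1.le _)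
  have hint : IntegrableOn (fun t : ℝ => t ^ α) (Ioo (0 : ℝ) (1 / 2)) :=
    ⟨(measurable_id.pow_const α).aestronglyMeasurable, (hasFiniteIntegral_iff_ofReal hnn).2 hlt⟩
  have := (intervalIntegral.integrableOn_Ioo_rpow_iff (by norm_num : (0 : ℝ) < 1 / 2)).1 hint
  linarith

/-- `∫⁻_{(1/2,1)} ofReal((1−t)^β) = ∞` for `β ≤ −1` (reflection `t ↦ 1 − t` of the previous divergence).
[cite: Fischler2003RhinViola, §4.1 Proposition 13 (one-variable estimates)] -/
theorem lintegral_one_sub_rpow_eq_top {β : ℝ} (hβ : β ≤ -1) :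
    ∫⁻ t in Ioo (1 / 2 : ℝ) 1, ENNReal.ofReal ((1 - t) ^ β) = ∞ := by
  by_contra hne
  have hlt : ∫⁻ t in Ioo (1 / 2 : ℝ) 1, ENNReal.ofReal ((1 - t) ^ β) < ∞ := lt_top_iff_ne_top.2 hne
  have hnn : 0 ≤ᵐ[volume.restrict (Ioo (1 / 2 : ℝ) 1)] fun t : ℝ => (1 - t) ^ β :=
    (ae_restrict_iff' measurableSet_Ioo).2
      (Filter.Eventually.of_forall fun t ht => Real.rpow_nonneg (by linarith [ht.2]) _)
  have hint : IntegrableOn (fun t : ℝ => (1 - t) ^ β) (Ioo (1 / 2 : ℝ) 1) :=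
    ⟨((measurable_const.sub measurable_id).pow_const β).aestronglyMeasurable,
      (hasFiniteIntegral_iff_ofReal hnn).2 hlt⟩
  have h1 : IntervalIntegrable (fun t : ℝ => (1 - t) ^ β) volume (1 / 2) 1 :=
    (intervalIntegrable_iff_integrableOn_Ioo_of_le (by norm_num)).2 hint
  have h2 : IntervalIntegrable (fun t : ℝ => (1 - (1 - t)) ^ β) volume (1 - 1 / 2) (1 - 1) := h1.comp_sub_left 1
  have h2' := h2.symm
  rw [show (1 : ℝ) - 1 = 0 by norm_num, show (1 : ℝ) - 1 / 2 = 1 / 2 by norm_num] at h2'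
  have h3 : IntegrableOn (fun t : ℝ => (1 - (1 - t)) ^ β) (Ioo (0 : ℝ) (1 / 2)) :=
    (intervalIntegrable_iff_integrableOn_Ioo_of_le (by norm_num)).1 h2'
  have h4 : IntegrableOn (fun t : ℝ => t ^ β) (Ioo (0 : ℝ) (1 / 2)) :=
    h3.congr_fun (fun t _ => by simp) measurableSet_Ioo
  have := (intervalIntegral.integrableOn_Ioo_rpow_iff (by norm_num : (0 : ℝ) < 1 / 2)).1 h4
  linarith

/-- **Divergence at `t = 0`**: for `α ≤ −1` (any real `β, γ`) and `δ ∈ [0,1)`,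
`∫₀¹ t^α(1−t)^β(1−tδ)^{−γ}dt = ∞` (on `(0,1/2)` the other two factors are at least `2^{−|β|}`, `2^{−|γ|}`).
[cite: Fischler2003RhinViola, §4.1 Proposition 13 (one-variable estimates)] -/
theorem lintegral_eulerKernel_eq_top_of_le_left {α : ℝ} (hα : α ≤ -1) (β γ : ℝ) {δ : ℝ} (hδ0 : 0 ≤ δ)
    (hδ1 : δ < 1) : ∫⁻ t in Ioo (0 : ℝ) 1, ENNReal.ofReal (t ^ α * (1 - t) ^ β * (1 - t * δ) ^ (-γ)) = ∞ := by
  set κ : ℝ := (2 : ℝ) ^ (-|β|) * (2 : ℝ) ^ (-|γ|) with hκ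
  have hκ0 : 0 < κ := by rw [hκ]; positivity
  have hpt : ∀ t ∈ Ioo (0 : ℝ) (1 / 2), κ * t ^ α ≤ t ^ α * (1 - t) ^ β * (1 - t * δ) ^ (-γ) := by
    intro t ht
    have ht0 := ht.1
    have htb : (2 : ℝ) ^ (-|β|) ≤ (1 - t) ^ β := two_rpow_neg_abs_le (by linarith [ht.2]) (by linarith [ht.1])
    have htc : (2 : ℝ) ^ (-|γ|) ≤ (1 - t * δ) ^ (-γ) := by
      have h1 : t * δ ≤ 1 / 2 * 1 := mul_le_mul ht.2.le hδ1.le hδ0 (by norm_num)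
      have h2 : 0 ≤ t * δ := mul_nonneg ht0.le hδ0
      have h := two_rpow_neg_abs_le (z := -γ) (x := 1 - t * δ) (by linarith) (by linarith)
      rwa [abs_neg] at h
    calc κ * t ^ α = t ^ α * (2 : ℝ) ^ (-|β|) * (2 : ℝ) ^ (-|γ|) := by rw [hκ]; ring
      _ ≤ t ^ α * (1 - t) ^ β * (1 - t * δ) ^ (-γ) :=
          mul_le_mul (mul_le_mul_of_nonneg_left htb (Real.rpow_nonneg ht0.le _)) htc (by positivity)
            (mul_nonneg (Real.rpow_nonneg ht0.le _) (Real.rpow_nonneg (by linarith [ht.2]) _))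
  have hsub : Ioo (0 : ℝ) (1 / 2) ⊆ Ioo (0 : ℝ) 1 := fun t ht => ⟨ht.1, by linarith [ht.2]⟩
  refine eq_top_iff.2 ?_
  calc (⊤ : ℝ≥0∞) = ENNReal.ofReal κ * ∫⁻ t in Ioo (0 : ℝ) (1 / 2), ENNReal.ofReal (t ^ α) := by
        rw [lintegral_rpow_eq_top hα, ENNReal.mul_top (by simpa using hκ0)]
    _ = ∫⁻ t in Ioo (0 : ℝ) (1 / 2), ENNReal.ofReal (κ * t ^ α) := by
        rw [← lintegral_const_mul' _ _ ENNReal.ofReal_ne_top]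
        refine lintegral_congr fun t => ?_
        rw [ENNReal.ofReal_mul hκ0.le]
    _ ≤ ∫⁻ t in Ioo (0 : ℝ) (1 / 2), ENNReal.ofReal (t ^ α * (1 - t) ^ β * (1 - t * δ) ^ (-γ)) :=
        setLIntegral_mono' measurableSet_Ioo fun t ht => ENNReal.ofReal_le_ofReal (hpt t ht)
    _ ≤ _ := lintegral_mono_set hsub

/-- **Divergence at `t = 1`**: for `β ≤ −1` (any real `α, γ`) and `δ ∈ [0,1)`,
`∫₀¹ t^α(1−t)^β(1−tδ)^{−γ}dt = ∞` (on `(1/2,1)` the other two factors are at least `2^{−|α|}`, `(1−δ)^{|γ|}`).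
[cite: Fischler2003RhinViola, §4.1 Proposition 13 (one-variable estimates)] -/
theorem lintegral_eulerKernel_eq_top_of_le_right (α : ℝ) {β : ℝ} (hβ : β ≤ -1) (γ : ℝ) {δ : ℝ} (hδ0 : 0 ≤ δ)
    (hδ1 : δ < 1) : ∫⁻ t in Ioo (0 : ℝ) 1, ENNReal.ofReal (t ^ α * (1 - t) ^ β * (1 - t * δ) ^ (-γ)) = ∞ := by
  have h1δ : 0 < 1 - δ := by linarith
  set κ : ℝ := (2 : ℝ) ^ (-|α|) * (1 - δ) ^ |(-γ)| with hκ
  have hκ0 : 0 < κ := by rw [hκ]; positivity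
  have hpt : ∀ t ∈ Ioo (1 / 2 : ℝ) 1, κ * (1 - t) ^ β ≤ t ^ α * (1 - t) ^ β * (1 - t * δ) ^ (-γ) := by
    intro t ht
    have ht0 : 0 < t := by linarith [ht.1]
    have hta : (2 : ℝ) ^ (-|α|) ≤ t ^ α := two_rpow_neg_abs_le ht.1.le ht.2.le
    obtain ⟨hd1, hd2, hd3⟩ := one_sub_mul_mem ht0.le ht.2.le hδ0 hδ1
    have htc : (1 - δ) ^ |(-γ)| ≤ (1 - t * δ) ^ (-γ) := rpow_abs_le_rpow h1δ hd1 hd2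
    have h1t : 0 ≤ 1 - t := by linarith [ht.2]
    calc κ * (1 - t) ^ β = (2 : ℝ) ^ (-|α|) * (1 - t) ^ β * (1 - δ) ^ |(-γ)| := by rw [hκ]; ring
      _ ≤ t ^ α * (1 - t) ^ β * (1 - t * δ) ^ (-γ) :=
          mul_le_mul (mul_le_mul_of_nonneg_right hta (Real.rpow_nonneg h1t _)) htc (by positivity)
            (mul_nonneg (Real.rpow_nonneg ht0.le _) (Real.rpow_nonneg h1t _))
  have hsub : Ioo (1 / 2 : ℝ) 1 ⊆ Ioo (0 : ℝ) 1 := fun t ht => ⟨by linarith [ht.1], ht.2⟩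
  refine eq_top_iff.2 ?_
  calc (⊤ : ℝ≥0∞) = ENNReal.ofReal κ * ∫⁻ t in Ioo (1 / 2 : ℝ) 1, ENNReal.ofReal ((1 - t) ^ β) := by
        rw [lintegral_one_sub_rpow_eq_top hβ, ENNReal.mul_top (by simpa using hκ0)]
    _ = ∫⁻ t in Ioo (1 / 2 : ℝ) 1, ENNReal.ofReal (κ * (1 - t) ^ β) := by
        rw [← lintegral_const_mul' _ _ ENNReal.ofReal_ne_top]
        refine lintegral_congr fun t => ?_
        rw [ENNReal.ofReal_mul hκ0.le]
    _ ≤ ∫⁻ t in Ioo (1 / 2 : ℝ) 1, ENNReal.ofReal (t ^ α * (1 - t) ^ β * (1 - t * δ) ^ (-γ)) :=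
        setLIntegral_mono' measurableSet_Ioo fun t ht => ENNReal.ofReal_le_ofReal (hpt t ht)
    _ ≤ _ := lintegral_mono_set hsub

end JnFinite

end Literature.NumberTheory.Irrationality.Fischler2002

end
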